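import Mathlib.Data.Nat.Choose.Basic
import Mathlib.Data.List.Basic

/-!
# Kernel-checked rows of the kangaroo atlas at `𝔽₉`-rational points (resolution observatory, `pub-rosobs`)

Companion to `KangarooAtlasCertF4`: the same computable walk of `KangarooAtlasCert` over the field with nine
elements `𝔽₉ = 𝔽₃[ω]/(ω² + 1)` (the modulus the atlas' engine A picks: the first irreducible monic quadratic
`x² + a₁x + a₀` in the order `a₀` outer, `a₁` inner), on Bérczi's Lemma-2 threefold
[cite: Berczi2026, Lemma 2] `z³ + x¹² + y⁶ + w⁹y⁴ + x⁹y⁸w¹⁰` over `𝔽₃` at its antelope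
`x¹⁰y²⁰w⁹ + x²⁴y³⁹w¹⁰`, `r = (10, 20, 0)`, shade `9` (the state of `KangarooAtlasCertDim4.berczi_lemma2_shades`):
chart `x`, point `(y, w) = (ω, 0)` and `(−ω, 0)` give shade `10` — increases at `𝔽₉ \ 𝔽₃`-rational points,
Frobenius (`c ↦ c³`) conjugates of each other, as the atlas' two Python engines print in the `kmax = 2` sweep
(KANGAROO-ATLAS-G3.md §B, PATTERNS C11).

Conventions as in `KangarooAtlasCert` (quoted from [cite: Hauser2010, §F–§G]).
This is a CERTIFICATE of finitely many computations, not a theorem about resolution.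
-/

namespace Literature.AlgebraicGeometry.Resolution.KangarooAtlasCertF9

/-- `𝔽₉ = {a₀ + a₁ω : a₀, a₁ ∈ 𝔽₃}`, `ω² = −1`. [folklore] -/
structure GF9 where
  a0 : Fin 3
  a1 : Fin 3
  deriving DecidableEq, Repr

namespace GF9

/-- zero. [folklore] -/
def zero : GF9 := ⟨0, 0⟩
/-- one. [folklore] -/
def one : GF9 := ⟨1, 0⟩
/-- `ω`. [folklore] -/
def om : GF9 := ⟨0, 1⟩
/-- `−ω = ω³`. [folklore] -/
def nom : GF9 := ⟨0, 2⟩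
/-- `−1`. [folklore] -/
def two : GF9 := ⟨2, 0⟩

/-- addition. [folklore] -/
def add (a b : GF9) : GF9 := ⟨a.a0 + b.a0, a.a1 + b.a1⟩
/-- multiplication, `ω² = −1`. [folklore] -/
def mul (a b : GF9) : GF9 := ⟨a.a0 * b.a0 - a.a1 * b.a1, a.a0 * b.a1 + a.a1 * b.a0⟩
/-- `n • a`. [folklore] -/
def nsmul (n : ℕ) (a : GF9) : GF9 := if n % 3 = 0 then zero else if n % 3 = 1 then a else add a a
/-- `a ^ n`. [folklore] -/
def pow (a : GF9) : ℕ → GF9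
  | 0 => one
  | n + 1 => mul a (pow a n)
/-- the Frobenius `c ↦ c³`. [folklore] -/
def frob (a : GF9) : GF9 := mul a (mul a a)

end GF9

/-- exponent vector of a monomial. [folklore] -/
abbrev Mon := List ℕ
/-- sparse polynomial over `𝔽₉`. [folklore] -/
abbrev Poly := List (Mon × GF9)

/-- total degree. [folklore] -/
def deg (m : Mon) : ℕ := m.sum

/-- add one term to a normalised term list. [folklore] -/
def addTerm (t : Mon × GF9) : Poly → Poly
  | [] => if t.2 = GF9.zero then [] else [t]
  | (m, c) :: rest =>
      if m = t.1 then
        (let s := GF9.add c t.2; if s = GF9.zero then rest else (m, s) :: rest)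
      else (m, c) :: addTerm t rest

/-- collect equal monomials, drop zero coefficients. [folklore] -/
def normalize (P : Poly) : Poly := P.foldl (fun acc t => addTerm t acc) []

/-- order at the origin (`0` for the zero polynomial; callers test emptiness). [folklore] -/
def ord (P : Poly) : ℕ :=
  match P with
  | [] => 0
  | t :: rest => rest.foldl (fun a s => min a (deg s.1)) (deg t.1)

/-- cleaning: remove all `q`-th-power monomials (`𝔽₉` is perfect). [cite: Hauser2010, §G] -/
def clean (q : ℕ) (P : Poly) : Poly := P.filter (fun t => t.1.any (fun e => e % q ≠ 0))

/-- point blow-up, chart `y_j`, strict transform divided by `y_j^q`. [cite: Hauser2010, §G] -/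
def blowup (j q : ℕ) (P : Poly) : Poly := P.map (fun t => (t.1.set j (deg t.1 - q), t.2))

/-- `y_i ↦ y_i + b` on one variable, by the binomial theorem. [folklore] -/
def translateVar (i : ℕ) (b : GF9) (P : Poly) : Poly :=
  normalize (P.flatMap (fun t =>
    let n := t.1.getD i 0
    (List.range (n + 1)).map (fun k =>
      (t.1.set i k, GF9.nsmul (Nat.choose n k) (GF9.mul t.2 (GF9.pow b (n - k)))))))

/-- translation `y ↦ y + b`, one variable at a time. [folklore] -/
def translate (b : List GF9) (P : Poly) : Poly :=
  (List.range b.length).foldl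
    (fun acc i => if b.getD i GF9.zero = GF9.zero then acc else translateVar i (b.getD i GF9.zero) acc) P

/-- a state of the walk. [cite: Hauser2010, §F] -/
structure State where
  F : Poly
  r : List ℕ
  deriving Repr, DecidableEq

/-- Hauser's shade `ord F_clean − Σ r_i`. [cite: Hauser2010, §F] -/
def shade (s : State) : ℕ := ord s.F - s.r.sum

/-- one blow-up step at `(chart j, point b)`; `none` if the point is not `q`-fold. [cite: Hauser2010, §G] -/
def step (q : ℕ) (s : State) (j : ℕ) (b : List GF9) : Option State :=
  let oF := ord s.F
  let rj := s.r.set j (oF - q)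
  let G := translate b (blowup j q s.F)
  if G.all (fun t => deg t.1 = 0 ∨ q ≤ deg t.1) then
    let Gc := clean q (G.filter (fun t => deg t.1 ≠ 0))
    let rb := (List.range rj.length).map (fun i => if b.getD i GF9.zero ≠ GF9.zero then 0 else rj.getD i 0)
    some ⟨Gc, rb⟩
  else none

/-- coefficientwise Frobenius of a state. [folklore] -/
def frobState (s : State) : State := ⟨s.F.map (fun t => (t.1, GF9.frob t.2)), s.r⟩

/-! ## Bérczi's Lemma-2 threefold, variables `(x, y, w)`, `p = q = 3` -/

/-- the antelope `x¹⁰y²⁰w⁹ + x²⁴y³⁹w¹⁰`, `r = (10, 20, 0)` (atlas row, computation). [cite: Berczi2026, Lemma 2] -/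
def antelope : State := ⟨[([10, 20, 9], GF9.one), ([24, 39, 10], GF9.one)], [10, 20, 0]⟩

/-- its shade is `9`. [folklore] -/
theorem antelope_shade : shade antelope = 9 := by decide

/-- chart `x`, point `(y, w) = (ω, 0)`: shade `10` — an increase at an `𝔽₉ \ 𝔽₃`-rational point (both engines print it). [folklore] -/
theorem omega_shades : (step 3 antelope 0 [GF9.zero, GF9.om, GF9.zero]).map shade = some 10 := by decide

/-- the multiplicities after that step: `r = (36, 0, 0)` (the translated component `y` is reset). [folklore] -/
theorem omega_r : (step 3 antelope 0 [GF9.zero, GF9.om, GF9.zero]).map State.r = some [36, 0, 0] := by decide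

/-- the initial-degree term of the kangaroo state is `ω·x³⁶ y w⁹` (degree `46 = 36 + 10`). [folklore] -/
theorem omega_initial_term :
    (step 3 antelope 0 [GF9.zero, GF9.om, GF9.zero]).map (fun s => s.F.filter (fun t => deg t.1 = 46)) =
      some [([36, 1, 9], GF9.om)] := by decide

/-- chart `x`, point `(y, w) = (−ω, 0)`: shade `10` as well. [folklore] -/
theorem nomega_shades : (step 3 antelope 0 [GF9.zero, GF9.nom, GF9.zero]).map shade = some 10 := by decide

/-- the `(−ω, 0)` state is the Frobenius conjugate of the `(ω, 0)` state. [folklore] -/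
theorem nomega_is_frob_of_omega :
    (step 3 antelope 0 [GF9.zero, GF9.om, GF9.zero]).map frobState =
      step 3 antelope 0 [GF9.zero, GF9.nom, GF9.zero] := by decide

/-- the rational sibling `(y, w) = (1, 0)` gives shade `10` in the same model
(= `KangarooAtlasCertDim4.berczi_lemma2_shades` over `𝔽₃`). [folklore] -/
theorem one_shades : (step 3 antelope 0 [GF9.zero, GF9.one, GF9.zero]).map shade = some 10 := by decide

/-- Moh's bound at the `(ω, 0)` increase: `10 ≤ 9 + 3⁰`. [cite: Moh1987, Stability Theorem] -/
theorem omega_moh : ∀ s ∈ step 3 antelope 0 [GF9.zero, GF9.om, GF9.zero], shade s ≤ shade antelope + 1 := by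
  decide

end Literature.AlgebraicGeometry.Resolution.KangarooAtlasCertF9
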